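import Literature.Geometry.Lorentzian.IPlusRegular
import Literature.Geometry.Lorentzian.KillingOnIntegralCurveUnique
import Literature.Geometry.Manifold.MaximalIntegralCurve
import Mathlib.Geometry.Manifold.IntegralCurve.ExistUnique
import Mathlib.Geometry.Manifold.IntegralCurve.Transform
import Mathlib.Analysis.Calculus.MeanValue
import HarnessLib

/-!
# Crux `HawkingExtensionIsKerr` (stmt-FinalStateConjecture-17840), line `SketchIdeator2` —
# programme SEC, brick SEC-1: kinematics of `K`-charts (chart lines are integral curves)

Helper file of the line lead (c7), registered sub-goal `stub_sec_chartLines`.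

Programme SEC builds a smooth spacelike section of the event horizon `𝓑.horizon` of a stationary
black hole from "K-charts": pairs of mutually inverse smooth maps `χ : W → O ⊆ E4`,
`χi : O → W` (`W` open inside the open domain `U` of a Killing field `K`) which STRAIGHTEN the
field, `dχ_x (K x) = e₀ := EuclideanSpace.single 0 1`.  This file proves the kinematics of such a
pair, from Mathlib's manifold calculus and the tree's uniqueness of integral curves of a local
Killing field (`IsKillingFieldOn.eqOn_of_isMIntegralCurveOn`, Lee 2013 Thm. 9.12 (a)):

* `hasDerivAt_comp_of_hasMFDerivAt`, `hasMFDerivAt_comp_of_hasDerivAt` — the two chain rules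
  bridging curves in the spacetime and curves in the model space `E4`;
* `mfderiv_chartInv_apply_e0` — `dχi_y e₀ = K (χi y)` for `y ∈ O` (chain rule on `χi ∘ χ = id`
  near `χi y`);
* `hasMFDerivAt_chartLine`, `isMIntegralCurveOn_chartLine` — (a) the chart line
  `σ ↦ χi (χ x + σ e₀)` is an integral curve of `K` wherever it stays in `O`;
* `chart_integralCurve_eq` — (b) an integral curve `γ` of `K` inside `W` reads
  `χ (γ t) = χ (γ t₀) + (t - t₀) e₀` (`χ ∘ γ - t e₀` has zero derivative on the connected
  `Ioo a b`);
* `chartLine_mem_horizon` — (c) if `K` is locally tangent to the horizon (integral curves through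
  horizon points stay in it for a short time) and the horizon is relatively closed in `W`
  (`= {F = 0}` for a continuous `F`), the chart line through a horizon point of `W` stays in the
  horizon as long as it stays in the box (clopen argument on `Ioo a b`);
* `stub_sec_chartLines` — the registered closed form (conjunction of (a), (b), (c)).
-/

noncomputable section

set_option linter.dupNamespace false

namespace Summit.FinalStateConjecture.FinalStateConjecture.Theorems.HawkingExtensionIsKerr.SketchIdeator2

open Set Filter Bundle Function Literature.Geometry.Lorentzian
open scoped Manifold ContDiff Topology

section KChart

variable (𝓑 : StationaryAFBlackHole.{0})
  {K : Π x : 𝓑.carrier, TangentSpace (𝓡 4) x} {W : Set 𝓑.carrier} {O : Set E4}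
  {χ : 𝓑.carrier → E4} {χi : E4 → 𝓑.carrier}

set_option backward.isDefEq.respectTransparency false in
/-- **Chain rule: a spacetime curve followed by a map into the model space.**  If `γ` has
velocity `v` at `t` and `f : M → E4` is differentiable at `γ t`, then `f ∘ γ` has (vector-space)
derivative `df (v)` at `t` (the computation of Mathlib's `IsMIntegralCurveOn.hasDerivWithinAt` for
an arbitrary differentiable map in place of a chart). -/
theorem hasDerivAt_comp_of_hasMFDerivAt {f : 𝓑.carrier → E4} (γ : ℝ → 𝓑.carrier) {t : ℝ}
    {v : TangentSpace (𝓡 4) (γ t)} {u : E4}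
    (hγ : HasMFDerivAt 𝓘(ℝ, ℝ) (𝓡 4) γ t ((1 : ℝ →L[ℝ] ℝ).smulRight v))
    (hf : MDifferentiableAt (𝓡 4) 𝓘(ℝ, E4) f (γ t))
    (hu : mfderiv (𝓡 4) 𝓘(ℝ, E4) f (γ t) v = u) : HasDerivAt (f ∘ γ) u t := by
  subst hu
  rw [hasDerivAt_iff_hasFDerivAt, ← hasMFDerivAt_iff_hasFDerivAt]
  apply (hf.hasMFDerivAt.comp t hγ).congr_mfderiv
  refine ContinuousLinearMap.ext fun a : ℝ => ?_
  change (mfderiv (𝓡 4) 𝓘(ℝ, E4) f (γ t)) (((1 : ℝ →L[ℝ] ℝ) a) • v) =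
    a • (mfderiv (𝓡 4) 𝓘(ℝ, E4) f (γ t)) v
  rw [map_smul]
  rfl

set_option backward.isDefEq.respectTransparency false in
/-- **Chain rule: a model-space curve followed by a map into spacetime.**  If `c : ℝ → E4` has
derivative `w` at `σ` and `g : E4 → M` is differentiable at `c σ`, then `g ∘ c` has velocity
`dg (w)` at `σ`. -/
theorem hasMFDerivAt_comp_of_hasDerivAt {g : E4 → 𝓑.carrier} (c : ℝ → E4) {σ : ℝ}
    {w : TangentSpace 𝓘(ℝ, E4) (c σ)} {u : TangentSpace (𝓡 4) (g (c σ))}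
    (hc : HasDerivAt c w σ) (hg : MDifferentiableAt 𝓘(ℝ, E4) (𝓡 4) g (c σ))
    (hu : mfderiv 𝓘(ℝ, E4) (𝓡 4) g (c σ) w = u) :
    HasMFDerivAt 𝓘(ℝ, ℝ) (𝓡 4) (g ∘ c) σ ((1 : ℝ →L[ℝ] ℝ).smulRight u) := by
  subst hu
  rw [hasDerivAt_iff_hasFDerivAt, ← hasMFDerivAt_iff_hasFDerivAt] at hc
  apply (hg.hasMFDerivAt.comp σ hc).congr_mfderiv
  refine ContinuousLinearMap.ext fun a : ℝ => ?_
  change (mfderiv 𝓘(ℝ, E4) (𝓡 4) g (c σ)) (((1 : ℝ →L[ℝ] ℝ) a) • w) =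
    a • (mfderiv 𝓘(ℝ, E4) (𝓡 4) g (c σ)) w
  rw [map_smul]
  rfl

/-- **Derivative of the inverse chart along `e₀`.**  For a pair of mutually inverse smooth maps
`χ : W → O`, `χi : O → W` (`W`, `O` open) with `dχ_x (K x) = e₀` on `W`, the inverse chart maps
`e₀` back to the field: `dχi_y e₀ = K (χi y)` for `y ∈ O`.  Chain rule on `χi ∘ χ = id` near
`χi y ∈ W`. -/
theorem mfderiv_chartInv_apply_e0 (hW : IsOpen W) (hO : IsOpen O)
    (hχ : ∀ x ∈ W, χ x ∈ O ∧ χi (χ x) = x) (hχi : ∀ y ∈ O, χi y ∈ W ∧ χ (χi y) = y)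
    (hχs : ContMDiffOn (𝓡 4) 𝓘(ℝ, E4) ∞ χ W) (hχis : ContMDiffOn 𝓘(ℝ, E4) (𝓡 4) ∞ χi O)
    (hstr : ∀ x ∈ W, mfderiv (𝓡 4) 𝓘(ℝ, E4) χ x (K x) = EuclideanSpace.single 0 1)
    {y : E4} (hy : y ∈ O) :
    mfderiv 𝓘(ℝ, E4) (𝓡 4) χi y (EuclideanSpace.single 0 1) = K (χi y) := by
  obtain ⟨hyW, hχy⟩ := hχi y hy
  -- the statement at `χ (χi y)` in place of `y`
  have key : ∀ x ∈ W,
      mfderiv 𝓘(ℝ, E4) (𝓡 4) χi (χ x) (EuclideanSpace.single 0 1) = K x := by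
    intro x hx
    have hχd : MDifferentiableAt (𝓡 4) 𝓘(ℝ, E4) χ x :=
      (hχs.contMDiffAt (hW.mem_nhds hx)).mdifferentiableAt (by simp)
    have hχid : MDifferentiableAt 𝓘(ℝ, E4) (𝓡 4) χi (χ x) :=
      (hχis.contMDiffAt (hO.mem_nhds (hχ x hx).1)).mdifferentiableAt (by simp)
    have hev : (χi ∘ χ) =ᶠ[𝓝 x] id :=
      Filter.eventuallyEq_of_mem (hW.mem_nhds hx) fun z hz ↦ (hχ z hz).2
    have h1 : mfderiv (𝓡 4) (𝓡 4) (χi ∘ χ) x (K x) = K x := by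
      rw [hev.mfderiv_eq, mfderiv_id]
      rfl
    have h2 : mfderiv (𝓡 4) (𝓡 4) (χi ∘ χ) x (K x) =
        mfderiv 𝓘(ℝ, E4) (𝓡 4) χi (χ x) (mfderiv (𝓡 4) 𝓘(ℝ, E4) χ x (K x)) := by
      rw [mfderiv_comp x hχid hχd]
      rfl
    rw [h1, hstr x hx] at h2
    exact h2.symm
  have h := key (χi y) hyW
  rw [hχy] at h
  exact h

/-- **(a), pointwise: velocity of a chart line.**  Wherever the chart line `σ ↦ χi (χ x + σ e₀)`
lies over `O`, its velocity is the field: `d/dσ χi (χ x + σ e₀) = K (χi (χ x + σ e₀))`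
(chain rule: the straight line has velocity `e₀`, and `dχi e₀ = K ∘ χi`). -/
theorem hasMFDerivAt_chartLine (hW : IsOpen W) (hO : IsOpen O)
    (hχ : ∀ x ∈ W, χ x ∈ O ∧ χi (χ x) = x) (hχi : ∀ y ∈ O, χi y ∈ W ∧ χ (χi y) = y)
    (hχs : ContMDiffOn (𝓡 4) 𝓘(ℝ, E4) ∞ χ W) (hχis : ContMDiffOn 𝓘(ℝ, E4) (𝓡 4) ∞ χi O)
    (hstr : ∀ x ∈ W, mfderiv (𝓡 4) 𝓘(ℝ, E4) χ x (K x) = EuclideanSpace.single 0 1)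
    (x : 𝓑.carrier) {σ : ℝ} (hσ : χ x + σ • EuclideanSpace.single 0 1 ∈ O) :
    HasMFDerivAt 𝓘(ℝ, ℝ) (𝓡 4) (fun τ : ℝ ↦ χi (χ x + τ • EuclideanSpace.single 0 1)) σ
      ((1 : ℝ →L[ℝ] ℝ).smulRight (K (χi (χ x + σ • EuclideanSpace.single 0 1)))) := by
  have hc : HasDerivAt (fun τ : ℝ ↦ χ x + τ • (EuclideanSpace.single 0 1 : E4))
      (EuclideanSpace.single 0 1) σ := by
    simpa using ((hasDerivAt_id σ).smul_const (EuclideanSpace.single 0 1 : E4)).const_add (χ x)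
  have hχid : MDifferentiableAt 𝓘(ℝ, E4) (𝓡 4) χi (χ x + σ • EuclideanSpace.single 0 1) :=
    (hχis.contMDiffAt (hO.mem_nhds hσ)).mdifferentiableAt (by simp)
  exact hasMFDerivAt_comp_of_hasDerivAt 𝓑 (fun τ : ℝ ↦ χ x + τ • (EuclideanSpace.single 0 1 : E4))
    hc hχid (mfderiv_chartInv_apply_e0 𝓑 hW hO hχ hχi hχs hχis hstr hσ)

/-- **(a): chart lines are integral curves.**  The chart line `σ ↦ χi (χ x + σ e₀)` is an
integral curve of `K` on every open interval over which it stays in the box `O`. -/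
theorem isMIntegralCurveOn_chartLine (hW : IsOpen W) (hO : IsOpen O)
    (hχ : ∀ x ∈ W, χ x ∈ O ∧ χi (χ x) = x) (hχi : ∀ y ∈ O, χi y ∈ W ∧ χ (χi y) = y)
    (hχs : ContMDiffOn (𝓡 4) 𝓘(ℝ, E4) ∞ χ W) (hχis : ContMDiffOn 𝓘(ℝ, E4) (𝓡 4) ∞ χi O)
    (hstr : ∀ x ∈ W, mfderiv (𝓡 4) 𝓘(ℝ, E4) χ x (K x) = EuclideanSpace.single 0 1)
    (x : 𝓑.carrier) {a b : ℝ}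
    (hline : ∀ σ ∈ Ioo a b, χ x + σ • EuclideanSpace.single 0 1 ∈ O) :
    IsMIntegralCurveOn (fun σ : ℝ ↦ χi (χ x + σ • EuclideanSpace.single 0 1)) K (Ioo a b) :=
  fun σ hσ ↦ (hasMFDerivAt_chartLine 𝓑 hW hO hχ hχi hχs hχis hstr x (hline σ hσ)).hasMFDerivWithinAt

/-- **(b): integral curves read in the chart.**  An integral curve `γ` of `K` on `Ioo a b`
inside `W` reads `χ (γ t) = χ (γ t₀) + (t - t₀) e₀`: the map `t ↦ χ (γ t) - t e₀` has derivative
`dχ (K (γ t)) - e₀ = 0` on the open connected `Ioo a b`, hence is constant there. -/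
theorem chart_integralCurve_eq (hW : IsOpen W)
    (hχs : ContMDiffOn (𝓡 4) 𝓘(ℝ, E4) ∞ χ W)
    (hstr : ∀ x ∈ W, mfderiv (𝓡 4) 𝓘(ℝ, E4) χ x (K x) = EuclideanSpace.single 0 1)
    (γ : ℝ → 𝓑.carrier) {a b t₀ : ℝ} (ht₀ : t₀ ∈ Ioo a b) (hγ : IsMIntegralCurveOn γ K (Ioo a b))
    (hγW : ∀ t ∈ Ioo a b, γ t ∈ W) {t : ℝ} (ht : t ∈ Ioo a b) :
    χ (γ t) = χ (γ t₀) + (t - t₀) • EuclideanSpace.single 0 1 := by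
  have hd : ∀ s ∈ Ioo a b,
      HasDerivAt (fun s : ℝ ↦ χ (γ s) - s • (EuclideanSpace.single 0 1 : E4)) 0 s := by
    intro s hs
    have hχd : MDifferentiableAt (𝓡 4) 𝓘(ℝ, E4) χ (γ s) :=
      (hχs.contMDiffAt (hW.mem_nhds (hγW s hs))).mdifferentiableAt (by simp)
    have h4 : HasDerivAt (χ ∘ γ) (EuclideanSpace.single 0 1 : E4) s :=
      hasDerivAt_comp_of_hasMFDerivAt 𝓑 γ (hγ.hasMFDerivAt_of_isOpen isOpen_Ioo hs) hχd
        (hstr _ (hγW s hs))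
    have h5 := h4.fun_sub ((hasDerivAt_id s).smul_const (EuclideanSpace.single 0 1 : E4))
    simpa using h5
  have hdiff : DifferentiableOn ℝ (fun s : ℝ ↦ χ (γ s) - s • (EuclideanSpace.single 0 1 : E4))
      (Ioo a b) := fun s hs ↦ (hd s hs).differentiableAt.differentiableWithinAt
  have hderiv : (Ioo a b).EqOn (deriv fun s : ℝ ↦ χ (γ s) - s • (EuclideanSpace.single 0 1 : E4))
      0 := fun s hs ↦ (hd s hs).deriv
  have h := isOpen_Ioo.is_const_of_deriv_eq_zero isPreconnected_Ioo hdiff hderiv ht ht₀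
  -- `h : χ (γ t) - t • e₀ = χ (γ t₀) - t₀ • e₀`
  have h' : χ (γ t) = χ (γ t₀) - t₀ • (EuclideanSpace.single 0 1 : E4)
      + t • (EuclideanSpace.single 0 1 : E4) := by
    rw [← h]; abel
  rw [h', sub_smul]
  abel

/-- **(c): chart lines through horizon points stay in the horizon.**  Let `K` be a Killing field
on the open `U ⊇ 𝓑.horizon`, `W ⊆ U`, and assume LOCAL TANGENCY (through every horizon point
there is an integral curve of `K` staying in the horizon for a short time) and that the horizon
is relatively closed in `W` (`= {F = 0} ∩ W`, `F` continuous on `W`).  Then for `x ∈ W ∩ horizon`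
the chart line `σ ↦ χi (χ x + σ e₀)` stays in the horizon on every interval `Ioo a b ∋ 0` over
which it stays in the box.  Clopen argument: the set of good parameters contains `0`, is
relatively closed (continuity of `F` along the line) and open (local uniqueness of integral curves
of `K` inside `U`, `IsKillingFieldOn.eqOn_of_isMIntegralCurveOn`, applied to the shifted chart
line and the tangent curve), and `Ioo a b` is preconnected. -/
theorem chartLine_mem_horizon [𝓑.metric.HasLeviCivita] {U : Set 𝓑.carrier} (hU : IsOpen U)
    (hHU : 𝓑.horizon ⊆ U) (hK : 𝓑.metric.toPseudoRiemannianMetric.IsKillingFieldOn K U)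
    (hW : IsOpen W) (hO : IsOpen O) (hWU : W ⊆ U)
    (hχ : ∀ x ∈ W, χ x ∈ O ∧ χi (χ x) = x) (hχi : ∀ y ∈ O, χi y ∈ W ∧ χ (χi y) = y)
    (hχs : ContMDiffOn (𝓡 4) 𝓘(ℝ, E4) ∞ χ W) (hχis : ContMDiffOn 𝓘(ℝ, E4) (𝓡 4) ∞ χi O)
    (hstr : ∀ x ∈ W, mfderiv (𝓡 4) 𝓘(ℝ, E4) χ x (K x) = EuclideanSpace.single 0 1)
    (htan : ∀ p ∈ 𝓑.horizon, ∃ ε > (0 : ℝ), ∃ γ : ℝ → 𝓑.carrier, γ 0 = p ∧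
      IsMIntegralCurveOn γ K (Ioo (-ε) ε) ∧ ∀ t ∈ Ioo (-ε) ε, γ t ∈ 𝓑.horizon)
    (hF : ∃ F : 𝓑.carrier → ℝ, ContinuousOn F W ∧ ∀ x ∈ W, x ∈ 𝓑.horizon ↔ F x = 0)
    {x : 𝓑.carrier} (hxW : x ∈ W) {a b : ℝ} (ha : a < 0) (hb : 0 < b)
    (hline : ∀ σ ∈ Ioo a b, χ x + σ • EuclideanSpace.single 0 1 ∈ O) (hx : x ∈ 𝓑.horizon)
    {σ : ℝ} (hσ : σ ∈ Ioo a b) :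
    χi (χ x + σ • EuclideanSpace.single 0 1) ∈ 𝓑.horizon := by
  obtain ⟨F, hFc, hFz⟩ := hF
  set c : ℝ → 𝓑.carrier := fun τ ↦ χi (χ x + τ • EuclideanSpace.single 0 1) with hc
  have hcurve : IsMIntegralCurveOn c K (Ioo a b) :=
    isMIntegralCurveOn_chartLine 𝓑 hW hO hχ hχi hχs hχis hstr x hline
  have hcW : ∀ τ ∈ Ioo a b, c τ ∈ W := fun τ hτ ↦ (hχi _ (hline τ hτ)).1
  -- the set of good parameters
  set S : Set ℝ := {τ | τ ∈ Ioo a b ∧ c τ ∈ 𝓑.horizon} with hS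
  -- `S` is open: local uniqueness of integral curves against the tangent curve
  have hSo : IsOpen S := by
    rw [Metric.isOpen_iff]
    rintro σ₀ ⟨hσ₀, hq⟩
    obtain ⟨ε, hε, γ, hγ0, hγ, hγH⟩ := htan (c σ₀) hq
    obtain ⟨δ, hδ, hδε, hδa, hδb⟩ : ∃ δ, 0 < δ ∧ δ ≤ ε ∧ δ ≤ σ₀ - a ∧ δ ≤ b - σ₀ :=
      ⟨min ε (min (σ₀ - a) (b - σ₀)),
        lt_min hε (lt_min (by linarith [hσ₀.1]) (by linarith [hσ₀.2])), min_le_left _ _,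
        (min_le_right _ _).trans (min_le_left _ _), (min_le_right _ _).trans (min_le_right _ _)⟩
    refine ⟨δ, hδ, fun τ hτ ↦ ?_⟩
    rw [Metric.mem_ball, Real.dist_eq, abs_lt] at hτ
    have hτab : τ ∈ Ioo a b := ⟨by linarith, by linarith⟩
    -- the shifted chart line is an integral curve on `Ioo (-δ) δ` through `c σ₀ = γ 0`
    have hshift : IsMIntegralCurveOn (c ∘ (· + σ₀)) K (Ioo (-δ) δ) :=
      (hcurve.comp_add σ₀).mono fun s hs ↦ by
        show s + σ₀ ∈ Ioo a b
        exact ⟨by linarith [hs.1], by linarith [hs.2]⟩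
    have heq : EqOn (c ∘ (· + σ₀)) γ (Ioo (-δ) δ) :=
      hK.eqOn_of_isMIntegralCurveOn hU isOpen_Ioo ordConnected_Ioo (t₀ := 0)
        ⟨by linarith, hδ⟩ hshift (hγ.mono (Ioo_subset_Ioo (by linarith) hδε))
        (fun s hs ↦ hWU (hcW _ ⟨by linarith [hs.1], by linarith [hs.2]⟩))
        (fun s hs ↦ hHU (hγH s ⟨by linarith [hs.1], by linarith [hs.2]⟩))
        (by simp [hγ0])
    refine ⟨hτab, ?_⟩
    have hcτ : c τ = γ (τ - σ₀) := by
      have h := heq (x := τ - σ₀) ⟨by linarith, by linarith⟩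
      simpa using h
    rw [hcτ]
    exact hγH _ ⟨by linarith, by linarith⟩
  -- `S` is relatively closed in `Ioo a b`: continuity of `F` along the line
  have hScl : closure S ∩ Ioo a b ⊆ S := by
    rintro τ ⟨hτcl, hτ⟩
    refine ⟨hτ, ?_⟩
    rw [hFz _ (hcW τ hτ)]
    have hcont : ContinuousAt (F ∘ c) τ := by
      have h1 : ContinuousAt c τ :=
        (hcurve.continuousOn.continuousWithinAt hτ).continuousAt (isOpen_Ioo.mem_nhds hτ)
      exact ContinuousAt.comp (hFc.continuousAt (hW.mem_nhds (hcW τ hτ))) h1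
    have hmem : (F ∘ c) τ ∈ closure ((F ∘ c) '' S) :=
      hcont.continuousWithinAt.mem_closure_image hτcl
    have hsub : (F ∘ c) '' S ⊆ {0} := by
      rintro _ ⟨s, ⟨hs, hsH⟩, rfl⟩
      exact (hFz _ (hcW s hs)).1 hsH
    have h0 := closure_mono hsub hmem
    rw [closure_singleton] at h0
    exact h0
  have h0S : (0 : ℝ) ∈ S := by
    refine ⟨⟨ha, hb⟩, ?_⟩
    show χi (χ x + (0 : ℝ) • EuclideanSpace.single 0 1) ∈ 𝓑.horizon
    rw [zero_smul, add_zero, (hχ x hxW).2]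
    exact hx
  have hsub : Ioo a b ⊆ S :=
    isPreconnected_Ioo.subset_of_closure_inter_subset hSo ⟨0, ⟨ha, hb⟩, h0S⟩ hScl
  exact (hsub hσ).2

end KChart

/-- **SEC-1 (K-chart kinematics), registered form.**  In a pair of mutually inverse smooth maps
`(χ, χi)` between an open `W ⊆ U` and an open `O ⊆ E4` which straightens the Killing field `K`
of the open `U ⊇ 𝓑.horizon`, `dχ (K) = e₀`: (a) the chart lines `σ ↦ χi (χ x + σ e₀)` are
integral curves of `K`; (b) every integral curve of `K` inside `W` reads
`χ (γ t) = χ (γ t₀) + (t - t₀) e₀`; (c) (local tangency + horizon relatively closed in `W`) the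
chart line through a horizon point stays in the horizon for as long as it stays in the box.
Assembled from `isMIntegralCurveOn_chartLine`, `chart_integralCurve_eq`,
`chartLine_mem_horizon`. -/
theorem stub_sec_chartLines : ∀ (𝓑 : StationaryAFBlackHole.{0}) [𝓑.metric.HasLeviCivita] (U : Set 𝓑.carrier) (K : Π x : 𝓑.carrier, TangentSpace (𝓡 4) x), IsOpen U → 𝓑.horizon ⊆ U → 𝓑.metric.toPseudoRiemannianMetric.IsKillingFieldOn K U → ∀ (W : Set 𝓑.carrier) (O : Set E4) (χ : 𝓑.carrier → E4) (χi : E4 → 𝓑.carrier), IsOpen W → IsOpen O → W ⊆ U → (∀ x ∈ W, χ x ∈ O ∧ χi (χ x) = x) → (∀ y ∈ O, χi y ∈ W ∧ χ (χi y) = y) → ContMDiffOn (𝓡 4) 𝓘(ℝ, E4) ∞ χ W → ContMDiffOn 𝓘(ℝ, E4) (𝓡 4) ∞ χi O → (∀ x ∈ W, mfderiv (𝓡 4) 𝓘(ℝ, E4) χ x (K x) = EuclideanSpace.single 0 1) →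
    (∀ x ∈ W, ∀ a b : ℝ, (∀ σ ∈ Ioo a b, χ x + σ • EuclideanSpace.single 0 1 ∈ O) → IsMIntegralCurveOn (fun σ : ℝ ↦ χi (χ x + σ • EuclideanSpace.single 0 1)) K (Ioo a b)) ∧
    (∀ (γ : ℝ → 𝓑.carrier) (a b t₀ : ℝ), t₀ ∈ Ioo a b → IsMIntegralCurveOn γ K (Ioo a b) → (∀ t ∈ Ioo a b, γ t ∈ W) → ∀ t ∈ Ioo a b, χ (γ t) = χ (γ t₀) + (t - t₀) • EuclideanSpace.single 0 1) ∧
    ((∀ p ∈ 𝓑.horizon, ∃ ε > (0 : ℝ), ∃ γ : ℝ → 𝓑.carrier, γ 0 = p ∧ IsMIntegralCurveOn γ K (Ioo (-ε) ε) ∧ ∀ t ∈ Ioo (-ε) ε, γ t ∈ 𝓑.horizon) → (∃ F : 𝓑.carrier → ℝ, ContinuousOn F W ∧ ∀ x ∈ W, x ∈ 𝓑.horizon ↔ F x = 0) → ∀ x ∈ W, ∀ a b : ℝ, a < 0 → 0 < b → (∀ σ ∈ Ioo a b, χ x + σ • EuclideanSpace.single 0 1 ∈ O) → x ∈ 𝓑.horizon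 → ∀ σ ∈ Ioo a b, χi (χ x + σ • EuclideanSpace.single 0 1) ∈ 𝓑.horizon) := by
  intro 𝓑 _ U K hU hHU hK W O χ χi hW hO hWU hχ hχi hχs hχis hstr
  refine ⟨fun x _ a b hline ↦ isMIntegralCurveOn_chartLine 𝓑 hW hO hχ hχi hχs hχis hstr x hline,
    fun γ a b t₀ ht₀ hγ hγW t ht ↦ chart_integralCurve_eq 𝓑 hW hχs hstr γ ht₀ hγ hγW ht,
    fun htan hF x hxW a b ha hb hline hx σ hσ ↦ ?_⟩
  exact chartLine_mem_horizon 𝓑 hU hHU hK hW hO hWU hχ hχi hχs hχis hstr htan hF hxW ha hb hline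
    hx hσ

end Summit.FinalStateConjecture.FinalStateConjecture.Theorems.HawkingExtensionIsKerr.SketchIdeator2

end
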